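import Summits.MatrixMultiplication.MatrixMultiplication.Theorems.LevelGradedCohnUmansLevelOneGL2DesignsTangencyUnipotentSymmetry

/-!
# Tangency sets with a unipotent symmetry are Paley lifts — wall-breaker axis
`Hermitian unital constructions` for the packing stub `stub_tangencySets` of the crux
`LevelOneGL2Designs` (stmt-MatrixMultiplication-14080, route `LevelGradedCohnUmans`), part II:
every affinity of order `p`

Part I (`…TangencyUnipotentSymmetry`) treated the normal forms.  Here the normal forms are shown
to be exhaustive, giving the main theorem of the axis in invariant form:

* `exists_eq_smul_of_dotProduct_eq_zero`, `exists_rankOne_of_mul_self_eq_zero` — plane linear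
  algebra: a non-zero `2 × 2` matrix `N` with `N² = 0` acts by `N v = (f ⬝ᵥ v) • e` with
  `e, f ≠ 0`, `f ⬝ᵥ e = 0`;
* `mul_self_eq_zero_of_pow_prime_eq_one` — over `𝔽_p`, `M^p = 1` forces `(M − 1)² = 0`
  (Frobenius + Cayley–Hamilton);
* `card_of_pow_prime_symmetry` — **main theorem**: `p` odd, `V ⊆ AG(2,p)` an affine tangency set
  invariant under an affinity `v ↦ Mv + t ≠ id` with `M^p = 1` (equivalently: under an affinity
  of order `p`) ⇒ `|V| ≤ p + 1`, or `|V| = p·|I|` for a Paley coclique `I ⊆ 𝔽_p`.  The affine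
  coordinates `(f ⬝ᵥ v, h ⬝ᵥ v)` conjugate the symmetry to the normal form of part I;
* `card_sq_le_of_pow_prime_symmetry` — hence `|V|² ≤ p³` (`ParabolaLift.card_coclique_sq_le`).

Reading for the crux.  The affine Hermitian unital over `𝔽_{r²}` — the model behind the exponent
`3/2` — is an orbit of a `p`-group of affinities; Hunter–Pohoata–Verstraëte–Zhang
(arXiv:2601.19879, §10) describe the prime-field problem as realising a "unitary-like
configuration" on the `p^{3/2}` scale.  Over `𝔽_p` ANY symmetry of order `p` collapses such a
configuration onto the Szőnyi parabola pencil, so the `p`-symmetric sub-world of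
`stub_tangencySets` is exactly the Paley coclique problem `α(P_p) ≥ c√p` (part III makes this an
`iff` in the stub's quantifier shape) — open for every prime, capped at `√(p/2) + 1`
(Hanson–Petridis 2021) and expected to fail (`ω(P_p) = p^{o(1)}`).  So constructions at
`c·p^{3/2}` over prime fields with a symmetry of order `p` are impossible for `c > 1/√2` (by the
Hanson–Petridis bound, not in tree) and, for `c ≤ 1/√2`, exist only if Paley cocliques of size
`c√p` do.  All statements are elementary and fully proved; no definitions, no named facts.
-/

set_option linter.dupNamespace false

noncomputable section

open Finset Matrix

namespace Summit.MatrixMultiplication.MatrixMultiplication.Theorems.LevelOneGL2Designs.UnipotentSymmetry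

variable {p : ℕ} [Fact p.Prime]

/-! ## Linear algebra of the plane `𝔽_p²` -/

/-- In the plane, the vectors orthogonal (for `⬝ᵥ`) to a non-zero vector `f` form the line spanned
by any non-zero vector `e` orthogonal to `f`. [elementary] -/
theorem exists_eq_smul_of_dotProduct_eq_zero {e f d : Fin 2 → ZMod p} (he : e ≠ 0) (hf : f ≠ 0)
    (hfe : f ⬝ᵥ e = 0) (hfd : f ⬝ᵥ d = 0) : ∃ δ : ZMod p, d = δ • e := by
  rw [vec2_dotProduct] at hfe hfd
  have hf' : f 0 ≠ 0 ∨ f 1 ≠ 0 := by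
    by_contra h
    push Not at h
    exact hf (vec2_ext (by simpa using h.1) (by simpa using h.2))
  by_cases he0 : e 0 = 0
  · -- then `e 1 ≠ 0`, `f 1 = 0`, `f 0 ≠ 0`, `d 0 = 0`
    have he1 : e 1 ≠ 0 := fun h => he (vec2_ext (by simpa using he0) (by simpa using h))
    have hf1 : f 1 = 0 := by
      rw [he0, mul_zero, zero_add] at hfe
      exact (mul_eq_zero.mp hfe).resolve_right he1
    have hf0 : f 0 ≠ 0 := hf'.resolve_right (not_not.mpr hf1)
    have hd0 : d 0 = 0 := by
      rw [hf1, zero_mul, add_zero] at hfd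
      exact (mul_eq_zero.mp hfd).resolve_left hf0
    refine ⟨d 1 / e 1, vec2_ext ?_ ?_⟩
    · simp [he0, hd0]
    · simp [div_mul_cancel₀ _ he1]
  · refine ⟨d 0 / e 0, vec2_ext ?_ ?_⟩
    · simp [div_mul_cancel₀ _ he0]
    · simp only [Pi.smul_apply, smul_eq_mul]
      rcases hf' with hf0 | hf1
      · -- impossible unless consistent: use both relations
        by_cases hf1 : f 1 = 0
        · exfalso
          rw [hf1, zero_mul, add_zero] at hfe
          exact he0 ((mul_eq_zero.mp hfe).resolve_left hf0)
        · field_simp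
          have h1 : f 1 * e 1 = -(f 0 * e 0) := by linear_combination hfe
          have h2 : f 1 * d 1 = -(f 0 * d 0) := by linear_combination hfd
          have := mul_left_cancel₀ hf1 (a := f 1) (b := d 1 * e 0) (c := d 0 * e 1) ?_
          · linear_combination this
          · linear_combination e 0 * h2 - d 0 * h1
      · field_simp
        have h1 : f 1 * e 1 = -(f 0 * e 0) := by linear_combination hfe
        have h2 : f 1 * d 1 = -(f 0 * d 0) := by linear_combination hfd
        have := mul_left_cancel₀ hf1 (a := f 1) (b := d 1 * e 0) (c := d 0 * e 1) ?_
        · linear_combination this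
        · linear_combination e 0 * h2 - d 0 * h1

/-- **Rank-one form of a non-zero `2 × 2` matrix of square zero**: `N v = (f ⬝ᵥ v) • e` with
`e, f ≠ 0` and `f ⬝ᵥ e = 0` (the image of `N` is the line `𝔽_p e`, its kernel the line `f ⬝ᵥ v = 0`,
and `N² = 0` says image ⊆ kernel). [elementary] -/
theorem exists_rankOne_of_mul_self_eq_zero (N : Matrix (Fin 2) (Fin 2) (ZMod p)) (hN : N * N = 0)
    (hN0 : N ≠ 0) : ∃ e f : Fin 2 → ZMod p, e ≠ 0 ∧ f ≠ 0 ∧ f ⬝ᵥ e = 0 ∧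
      ∀ v : Fin 2 → ZMod p, N *ᵥ v = (f ⬝ᵥ v) • e := by
  have h00 : N 0 0 * N 0 0 + N 0 1 * N 1 0 = 0 := by
    have h := congr_fun (congr_fun hN 0) 0
    simpa [Matrix.mul_apply, Fin.sum_univ_two] using h
  have h01 : N 0 0 * N 0 1 + N 0 1 * N 1 1 = 0 := by
    have h := congr_fun (congr_fun hN 0) 1
    simpa [Matrix.mul_apply, Fin.sum_univ_two] using h
  have h10 : N 1 0 * N 0 0 + N 1 1 * N 1 0 = 0 := by
    have h := congr_fun (congr_fun hN 1) 0
    simpa [Matrix.mul_apply, Fin.sum_univ_two] using h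
  have h11 : N 1 0 * N 0 1 + N 1 1 * N 1 1 = 0 := by
    have h := congr_fun (congr_fun hN 1) 1
    simpa [Matrix.mul_apply, Fin.sum_univ_two] using h
  have hmulVec : ∀ v : Fin 2 → ZMod p,
      N *ᵥ v = ![N 0 0 * v 0 + N 0 1 * v 1, N 1 0 * v 0 + N 1 1 * v 1] := by
    intro v
    refine vec2_ext ?_ ?_ <;> simp [Matrix.mulVec, vec2_dotProduct]
  by_cases h1 : N 0 1 = 0
  · -- then `N 0 0 = N 1 1 = 0` and `N = [[0,0],[n,0]]` with `n ≠ 0`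
    have hn00 : N 0 0 = 0 := by
      rw [h1, zero_mul, add_zero] at h00
      exact (mul_self_eq_zero).mp h00
    have hn11 : N 1 1 = 0 := by
      rw [h1, mul_zero, zero_add] at h11
      exact (mul_self_eq_zero).mp h11
    have hn10 : N 1 0 ≠ 0 := by
      intro h
      apply hN0
      ext i j
      fin_cases i <;> fin_cases j <;> simp [hn00, h1, h, hn11]
    refine ⟨![0, 1], ![N 1 0, 0], ?_, ?_, ?_, ?_⟩
    · intro h
      simpa using congr_fun h 1
    · intro h
      exact hn10 (by simpa using congr_fun h 0)
    · rw [vec2_dotProduct]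
      simp
    · intro v
      rw [hmulVec]
      refine vec2_ext ?_ ?_
      · rw [cons_val_zero, Pi.smul_apply, smul_eq_mul, vec2_dotProduct, cons_val_zero, hn00, h1]
        simp
      · rw [cons_val_one, cons_val_fin_one, Pi.smul_apply, smul_eq_mul, vec2_dotProduct,
          cons_val_zero, cons_val_one, cons_val_fin_one, cons_val_one, cons_val_fin_one, hn11]
        ring
  · -- `e` = second column, `f = (N 0 0 / N 0 1, 1)`
    have htr : N 1 1 = -N 0 0 := by
      have h : N 0 1 * (N 0 0 + N 1 1) = 0 := by linear_combination h01
      have h' := (mul_eq_zero.mp h).resolve_left h1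
      linear_combination h'
    have hn10 : N 1 0 * N 0 1 = -(N 0 0 * N 0 0) := by linear_combination h00
    refine ⟨![N 0 1, N 1 1], ![N 0 0 / N 0 1, 1], ?_, ?_, ?_, ?_⟩
    · intro h
      exact h1 (by simpa using congr_fun h 0)
    · intro h
      have := congr_fun h 1
      simp at this
    · rw [vec2_dotProduct]
      simp only [cons_val_zero, cons_val_one, cons_val_fin_one]
      rw [div_mul_cancel₀ _ h1, htr]
      ring
    · intro v
      rw [hmulVec]
      refine vec2_ext ?_ ?_
      · rw [cons_val_zero, Pi.smul_apply, smul_eq_mul, vec2_dotProduct, cons_val_zero, cons_val_one,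
          cons_val_fin_one, cons_val_zero]
        field_simp
      · rw [cons_val_one, cons_val_fin_one, Pi.smul_apply, smul_eq_mul, vec2_dotProduct,
          cons_val_zero, cons_val_one, cons_val_fin_one, cons_val_one, cons_val_fin_one, htr]
        field_simp
        linear_combination v 0 * hn10

/-- Over `𝔽_p`, a `2 × 2` matrix with `M ^ p = 1` is unipotent: `(M - 1)² = 0`
(`(M - 1)^p = M^p - 1 = 0` in characteristic `p`, and a nilpotent `2 × 2` matrix has square zero by
Cayley–Hamilton). [elementary] -/
theorem mul_self_eq_zero_of_pow_prime_eq_one (M : Matrix (Fin 2) (Fin 2) (ZMod p))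
    (hM : M ^ p = 1) : (M - 1) * (M - 1) = 0 := by
  have hnil : IsNilpotent (M - 1) := by
    refine ⟨p, ?_⟩
    rw [sub_pow_char_of_commute p (Commute.one_right M), hM, one_pow, sub_self]
  have hcp : (M - 1).charpoly = Polynomial.X ^ 2 := by
    rw [← sub_eq_zero]
    have h := (Matrix.isNilpotent_charpoly_sub_pow_of_isNilpotent hnil).eq_zero
    simpa using h
  have h := Matrix.aeval_self_charpoly (M - 1)
  rw [hcp, map_pow, Polynomial.aeval_X, pow_two] at h
  exact h

/-! ## Every affinity of order `p`: conjugation to the normal form -/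

/-- **Tangency sets with a symmetry of order `p` are Paley lifts or small** (the main theorem of
the axis in invariant form).  Let `p` be an odd prime and let `V ⊆ AG(2,p)` be an affine tangency
set (every point carries a line meeting `V` only there) invariant under an affinity
`v ↦ Mv + t` with `M^p = 1` other than the identity — equivalently, under an affinity of order
`p`.  Then either `|V| ≤ p + 1`, or `|V| = p·|I|` for a Paley coclique `I ⊆ 𝔽_p` (no two distinct
elements differ by a square).  Proof: `M` is unipotent (`mul_self_eq_zero_of_pow_prime_eq_one`);
if `M = 1` the symmetry is a translation (`card_le_of_translate_mem`); otherwise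
`M - 1 = e ⊗ f` has rank one (`exists_rankOne_of_mul_self_eq_zero`) and the affine coordinates
`(f ⬝ᵥ v, h ⬝ᵥ v)` (`h ⬝ᵥ e ≠ 0`) conjugate the symmetry to the normal form
`(x, y) ↦ (x + f⬝t, y + (h⬝e)x + h⬝t)` of `card_of_unipotentNormalForm_mem`.  This is the
prime-field shadow of the affine Hermitian unital, an orbit geometry of a `p`-group: over `𝔽_p`
a unipotent symmetry forces the Szőnyi / parabola-pencil architecture and hence the Paley
clique problem. [elementary] -/
theorem card_of_pow_prime_symmetry (V : Finset (Fin 2 → ZMod p))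
    (hV : ∀ v ∈ V, ∃ u : Fin 2 → ZMod p, u ≠ 0 ∧ ∀ w ∈ V, u ⬝ᵥ w = u ⬝ᵥ v → w = v)
    (hp2 : p ≠ 2) (M : Matrix (Fin 2) (Fin 2) (ZMod p)) (t : Fin 2 → ZMod p) (hM : M ^ p = 1)
    (hne : M ≠ 1 ∨ t ≠ 0) (hinv : ∀ v ∈ V, M *ᵥ v + t ∈ V) :
    V.card ≤ p + 1 ∨ ∃ I : Finset (ZMod p), (∀ x ∈ I, ∀ y ∈ I, x ≠ y → ¬ IsSquare (x - y)) ∧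
      V.card = p * I.card := by
  classical
  set N := M - 1 with hN
  have hN2 : N * N = 0 := mul_self_eq_zero_of_pow_prime_eq_one M hM
  have hMv : ∀ v : Fin 2 → ZMod p, M *ᵥ v = v + N *ᵥ v := by
    intro v
    rw [hN, Matrix.sub_mulVec, Matrix.one_mulVec]
    abel
  by_cases hN0 : N = 0
  · -- translation
    have hM1 : M = 1 := by rwa [hN, sub_eq_zero] at hN0
    have ht : t ≠ 0 := hne.resolve_left (not_not.mpr hM1)
    left
    refine (card_le_of_translate_mem V hV ht fun v hv => ?_).trans (Nat.le_succ p)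
    have h := hinv v hv
    rwa [hM1, Matrix.one_mulVec] at h
  · obtain ⟨e, f, he, hf, hfe, hNv⟩ := exists_rankOne_of_mul_self_eq_zero N hN2 hN0
    -- a second coordinate `h` with `h ⬝ᵥ e ≠ 0`
    obtain ⟨i, hi⟩ : ∃ i, e i ≠ 0 := by
      by_contra hcon
      push Not at hcon
      exact he (funext hcon)
    set h : Fin 2 → ZMod p := Pi.single i 1 with hh
    have hhe : h ⬝ᵥ e ≠ 0 := by rwa [hh, single_dotProduct, one_mul]
    -- the coordinate change
    let L : (Fin 2 → ZMod p) → (Fin 2 → ZMod p) := fun v => ![f ⬝ᵥ v, h ⬝ᵥ v]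
    have hL0 : ∀ v, L v 0 = f ⬝ᵥ v := fun v => by simp [L]
    have hL1 : ∀ v, L v 1 = h ⬝ᵥ v := fun v => by simp [L]
    have hLinj : Function.Injective L := by
      intro v w hvw
      have h0 := congr_fun hvw 0
      have h1 := congr_fun hvw 1
      rw [hL0, hL0] at h0
      rw [hL1, hL1] at h1
      have hfd : f ⬝ᵥ (v - w) = 0 := by rw [dotProduct_sub, h0, sub_self]
      obtain ⟨δ, hδ⟩ := exists_eq_smul_of_dotProduct_eq_zero he hf hfe hfd
      have hhd : h ⬝ᵥ (v - w) = 0 := by rw [dotProduct_sub, h1, sub_self]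
      rw [hδ, dotProduct_smul, smul_eq_mul] at hhd
      have hδ0 : δ = 0 := (mul_eq_zero.mp hhd).resolve_right hhe
      rw [hδ0, zero_smul] at hδ
      exact sub_eq_zero.mp hδ
    set W := V.image L with hW
    -- `W` is a tangency set
    have hWtan : ∀ v ∈ W, ∃ u : Fin 2 → ZMod p, u ≠ 0 ∧ ∀ w ∈ W, u ⬝ᵥ w = u ⬝ᵥ v → w = v := by
      intro v' hv'
      obtain ⟨v, hv, rfl⟩ := mem_image.mp hv'
      obtain ⟨u, hu0, hu⟩ := hV v hv
      -- write `u = α f + β h`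
      set β := (u ⬝ᵥ e) / (h ⬝ᵥ e) with hβ
      have hed : e ⬝ᵥ (u - β • h) = 0 := by
        rw [dotProduct_sub, dotProduct_smul, smul_eq_mul, dotProduct_comm e u, dotProduct_comm e h,
          hβ, div_mul_cancel₀ _ hhe, sub_self]
      obtain ⟨α, hα⟩ := exists_eq_smul_of_dotProduct_eq_zero hf he
        (by rw [dotProduct_comm]; exact hfe) hed
      have hu_eq : u = α • f + β • h := by rw [← hα]; abel
      refine ⟨![α, β], ?_, ?_⟩
      · intro hαβ
        have hα0 : α = 0 := by simpa using congr_fun hαβ 0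
        have hβ0 : β = 0 := by simpa using congr_fun hαβ 1
        rw [hα0, hβ0, zero_smul, zero_smul, add_zero] at hu_eq
        exact hu0 hu_eq
      · intro w' hw' heq
        obtain ⟨w, hw, rfl⟩ := mem_image.mp hw'
        have key : ∀ z : Fin 2 → ZMod p, ![α, β] ⬝ᵥ L z = u ⬝ᵥ z := by
          intro z
          rw [vec2_dotProduct, hL0, hL1, hu_eq, add_dotProduct, smul_dotProduct, smul_dotProduct,
            smul_eq_mul, smul_eq_mul]
          simp
        rw [key, key] at heq
        rw [hu w hw heq]
    -- `W` is invariant under the normal form `(x, y) ↦ (x + f⬝t, y + (h⬝e) x + h⬝t)`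
    have hWinv : ∀ w ∈ W, ![w 0 + f ⬝ᵥ t, w 1 + ((h ⬝ᵥ e) * w 0 + h ⬝ᵥ t)] ∈ W := by
      intro w' hw'
      obtain ⟨v, hv, rfl⟩ := mem_image.mp hw'
      have hgv := hinv v hv
      rw [hMv, hNv] at hgv
      have himg : L (v + (f ⬝ᵥ v) • e + t) ∈ W := mem_image_of_mem _ hgv
      convert himg using 1
      refine vec2_ext ?_ ?_
      · rw [cons_val_zero, hL0, hL0, dotProduct_add, dotProduct_add, dotProduct_smul, smul_eq_mul,
          hfe, mul_zero, add_zero]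
      · rw [cons_val_one, cons_val_fin_one, hL1, hL1, hL0, dotProduct_add, dotProduct_add,
          dotProduct_smul, smul_eq_mul]
        ring
    have hWcard : W.card = V.card := card_image_of_injective _ hLinj
    rw [← hWcard]
    exact card_of_unipotentNormalForm_mem W hWtan hp2 hhe hWinv

/-- **The square-root ceiling for `p`-symmetric tangency sets.**  Under the hypotheses of
`card_of_pow_prime_symmetry`, `|V|² ≤ p³`: an affine tangency set of `AG(2,p)` with a symmetry of
order `p` has fewer than `p^{3/2}` points, with order `p^{3/2}` attained only through Paley
cocliques of order `√p`. [elementary] -/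
theorem card_sq_le_of_pow_prime_symmetry (V : Finset (Fin 2 → ZMod p))
    (hV : ∀ v ∈ V, ∃ u : Fin 2 → ZMod p, u ≠ 0 ∧ ∀ w ∈ V, u ⬝ᵥ w = u ⬝ᵥ v → w = v)
    (hp2 : p ≠ 2) (M : Matrix (Fin 2) (Fin 2) (ZMod p)) (t : Fin 2 → ZMod p) (hM : M ^ p = 1)
    (hne : M ≠ 1 ∨ t ≠ 0) (hinv : ∀ v ∈ V, M *ᵥ v + t ∈ V) : V.card ^ 2 ≤ p ^ 3 := by
  have hp3 : 3 ≤ p := by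
    have h2 := (Fact.out : p.Prime).two_le
    omega
  rcases card_of_pow_prime_symmetry V hV hp2 M t hM hne hinv with h | ⟨I, hI, hVI⟩
  · calc V.card ^ 2 ≤ (p + 1) ^ 2 := Nat.pow_le_pow_left h 2
      _ ≤ p ^ 3 := by nlinarith
  · have hI2 := ParabolaLift.card_coclique_sq_le I hI
    calc V.card ^ 2 = p ^ 2 * (I.card * I.card) := by rw [hVI]; ring
      _ ≤ p ^ 2 * p := Nat.mul_le_mul_left _ hI2
      _ = p ^ 3 := by ring

end Summit.MatrixMultiplication.MatrixMultiplication.Theorems.LevelOneGL2Designs.UnipotentSymmetry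

end
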